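import Summits.HodgeConjecture.HodgeConjecture.Theorems.Ring2WeilCoverageRealUnitNormPowersOfTwo
import Summits.HodgeConjecture.HodgeConjecture.Theorems.Ring2WeilCoverageFullSignatureDichotomy
import HarnessLib

/-!
# Weil-type family coverage — WHAT THE CONVERSE OF THEOREM L (i) GIVES THE CENSUS: at the exceptional levels
# `n ∈ {2^a, p^a, 2p^a}` every CM type of `ℚ(ζₙ)` with THEOREM L (ii) has the FULL unit-signature property, and EVERY
# polarisation type occurs on EVERY CM torus `ℂ^Φ/D(𝔪)`; under L (ii) «full signature» ⟺ «level exceptional»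

research route conditional on HC_CM; not a corollary; Q11.4-sentence-2 already refuted in dim ≥ 3.

Ring 2, WEIL-TYPE FAMILY-COVERAGE CENSUS (`HOME/WEIL-FAMILY-COVERAGE.md` `## b01`, block b01.45; owner ring2-b01), part 74
of the `Ring2WeilCoverage*` series.  Part 60b proved, for a general CM field `K` and a CM type `Φ` with THEOREM L (ii)
(`hU'`: every EVEN sign pattern on `Φ` is a real unit's), the complete law «type `𝔣₀` occurs on `ℂ^Φ/D(𝔪)` ⟺ (even
count ∨ some unit of `𝓞 K⁺` has negative norm)» and «full signature on `Φ` ⟺ some unit of `𝓞 K⁺` has negative norm».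
Parts 72/73 decide the right-hand disjunct for `K = ℚ(ζₙ)`, `n ≥ 3`: it HOLDS iff `n ∈ {2^a, p^a, 2p^a}`.  Hence:

* §1 `exists_units_norm_neg_of_exceptional`; **`forall_sign_of_exceptional`** — at an exceptional level every CM type
  `Φ` with L (ii) has ALL `2^{|Φ|}` unit signatures; **`forall_sign_iff_exceptional`** — under L (ii) on `Φ`, «every
  sign pattern on `Φ` is a real unit's» ⟺ `n ∈ {2^a, p^a, 2p^a}` (⟸ here; ⟹ part 67 `not_forall_sign` via part 68);
* §2 **`exists_pos_isOfType_of_exceptional`** — at an exceptional level, under L (ii) on `Φ`, EVERY type `𝔣₀` having a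
  skew representative on `D(𝔪)` occurs as the type of a `Φ`-POSITIVE divisor on `ℂ^Φ/D(𝔪)` (every lattice `𝔪`); on
  the principal torus `ℂ^Φ/Φ(ℤ[ζₙ])`: `exists_principal_of_exceptional` (an `ι`-compatible PRINCIPAL polarisation for
  EVERY `Φ`) and `exists_type_span_of_exceptional` (every principal type `(ϖ₀)`, `ϖ₀ ∈ 𝓞 K⁺ ∖ 0`).

So the degenerate behaviour found at `32` by computation (part 61: every signature, every type on every torus) is the
GENERAL behaviour of the exceptional levels, and ONLY of those (part 67): the census's polarisation-type question on
`ℤ[ζₙ]`-CM tori is two-sided (norm-sign law, parts 55/56) exactly at `n ∉ {2^a, p^a, 2p^a}` and trivial («everything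
occurs», given L (ii)) exactly at `n ∈ {2^a, p^a, 2p^a}`.

HONEST FRAMING: torus-level statements about Shimura's divisors of type `(K; Φ; 𝔣₀)` [Sh98 §14.3 Prop. 4–5] on CM tori
with CM by `ℤ[ζₙ]`, conditional on THEOREM L (ii) on `Φ` (hypothesis `hU'`, a tree theorem at the census levels, parts
15–23/61); nothing here is a statement about Hodge classes, `W_K`, general members or HC; `HC_CM` is used nowhere.  No
`def`, no named fact, no `sorry`.

References: [cite: Shimura1998, §14.3 Prop. 4–5, pp. 103–104]; [cite: Garbanati1976UnitsNormMinusOne];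
[cite: DummitDummitKisilevsky2019, §3 (Prop. 1–2, Hasse's unit)]; census b01.43 (B), b01.44 (C2), b01.45.
-/

noncomputable section

open scoped Classical nonZeroDivisors NumberField ComplexConjugate
open NumberField NumberField.ComplexEmbedding Module FractionalIdeal Complex

namespace Summit.HodgeConjecture.Ring2WeilCoverage.FullSignatureExceptionalLevels

open Literature.AlgebraicGeometry.Motives (CMType)
open Literature.NumberTheory.ComplexMultiplication
open Literature.NumberTheory.ComplexMultiplication.CMTypeLattice
open Summit.HodgeConjecture.Ring2WeilCoverage.FullSignature
open Summit.HodgeConjecture.Ring2WeilCoverage.FullSignatureDichotomy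
open Summit.HodgeConjecture.Ring2WeilCoverage.RealUnitNormPowersOfTwo

variable {K : Type} [Field K] [NumberField K] [IsCMField K] {n : ℕ} [NeZero n] {ζ : K}

/-! ### §1 Full unit signature at the exceptional levels -/

/-- **A unit of NEGATIVE norm at every exceptional level**: for `K = ℚ(ζₙ)`, `n ≥ 3`, `n ∈ {2^a, p^a, 2p^a}`, some unit
of `𝓞 K⁺` has `N_{K⁺/ℚ} < 0` (parts 72/73: one of norm `−1`).
research route conditional on HC_CM; not a corollary; Q11.4-sentence-2 already refuted in dim ≥ 3. [cite: Garbanati1976UnitsNormMinusOne] -/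
theorem exists_units_norm_neg_of_exceptional [IsCyclotomicExtension {n} ℚ K] (hζ : IsPrimitiveRoot ζ n) (hn2 : 2 < n)
    (hex : (∃ a : ℕ, n = 2 ^ a) ∨ ∃ p a : ℕ, p.Prime ∧ p ≠ 2 ∧ (n = p ^ a ∨ n = 2 * p ^ a)) :
    ∃ v : (𝓞 (maximalRealSubfield K))ˣ,
      Algebra.norm ℚ (((v : 𝓞 (maximalRealSubfield K)) : maximalRealSubfield K)) < 0 := by
  obtain ⟨v, hv⟩ := exists_units_norm_eq_neg_one_of_exceptional hζ hn2 hex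
  exact ⟨v, by rw [hv]; norm_num⟩

/-- **FULL SIGNATURE AT THE EXCEPTIONAL LEVELS.**  Let `K = ℚ(ζₙ)`, `n ≥ 3`, `n ∈ {2^a, p^a, 2p^a}`, and let `Φ` be a CM
type of `K` with THEOREM L (ii) (every EVEN sign pattern on `Φ` is a real unit's).  Then EVERY sign pattern `S ⊆ Φ` is
the pattern `{φ ∈ Φ : Re φ(u) < 0}` of a unit `u ∈ 𝓞 K` fixed by complex conjugation — the units of `K⁺` have all
`2^{|Φ|}` signatures on `Φ` (part 60b with the negative-norm unit of parts 72/73).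
research route conditional on HC_CM; not a corollary; Q11.4-sentence-2 already refuted in dim ≥ 3. [cite: Garbanati1976UnitsNormMinusOne] -/
theorem forall_sign_of_exceptional [IsCyclotomicExtension {n} ℚ K] (hζ : IsPrimitiveRoot ζ n) (hn2 : 2 < n)
    (hex : (∃ a : ℕ, n = 2 ^ a) ∨ ∃ p a : ℕ, p.Prime ∧ p ≠ 2 ∧ (n = p ^ a ∨ n = 2 * p ^ a)) (Φ : CMType K)
    (hU' : ∀ S : Set (K →+* ℂ), S ⊆ Φ.1 → Even S.ncard →
      ∃ u : (𝓞 K)ˣ, IsCMField.complexConj K ((u : 𝓞 K) : K) = ((u : 𝓞 K) : K) ∧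
        ∀ φ ∈ Φ.1, ((φ ((u : 𝓞 K) : K)).re < 0 ↔ φ ∈ S))
    (S : Set (K →+* ℂ)) (hS : S ⊆ Φ.1) :
    ∃ u : (𝓞 K)ˣ, IsCMField.complexConj K ((u : 𝓞 K) : K) = ((u : 𝓞 K) : K) ∧
      ∀ φ ∈ Φ.1, ((φ ((u : 𝓞 K) : K)).re < 0 ↔ φ ∈ S) := by
  obtain ⟨v, hv⟩ := exists_units_norm_neg_of_exceptional hζ hn2 hex
  exact forall_exists_units_sign_eq_of_norm_neg Φ hU' hv S hS

/-- **UNDER THEOREM L (ii): «FULL SIGNATURE ON `Φ`» ⟺ «THE LEVEL IS EXCEPTIONAL».**  For `K = ℚ(ζₙ)`, `n ≥ 3`, and a CM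
type `Φ` with L (ii): every sign pattern on `Φ` is a real unit's **iff** `n = 2^a`, `p^a` or `2p^a` (⟸ §1; ⟹ a full
signature gives a unit of `K⁺` of negative norm (part 60), impossible at the other levels by parts 67/68).  In
particular the property does not depend on `Φ`.
research route conditional on HC_CM; not a corollary; Q11.4-sentence-2 already refuted in dim ≥ 3. [cite: Garbanati1976UnitsNormMinusOne] -/
theorem forall_sign_iff_exceptional [IsCyclotomicExtension {n} ℚ K] (hζ : IsPrimitiveRoot ζ n) (hn2 : 2 < n)
    (Φ : CMType K)
    (hU' : ∀ S : Set (K →+* ℂ), S ⊆ Φ.1 → Even S.ncard →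
      ∃ u : (𝓞 K)ˣ, IsCMField.complexConj K ((u : 𝓞 K) : K) = ((u : 𝓞 K) : K) ∧
        ∀ φ ∈ Φ.1, ((φ ((u : 𝓞 K) : K)).re < 0 ↔ φ ∈ S)) :
    (∀ S : Set (K →+* ℂ), S ⊆ Φ.1 →
      ∃ u : (𝓞 K)ˣ, IsCMField.complexConj K ((u : 𝓞 K) : K) = ((u : 𝓞 K) : K) ∧
        ∀ φ ∈ Φ.1, ((φ ((u : 𝓞 K) : K)).re < 0 ↔ φ ∈ S)) ↔
      ((∃ a : ℕ, n = 2 ^ a) ∨ ∃ p a : ℕ, p.Prime ∧ p ≠ 2 ∧ (n = p ^ a ∨ n = 2 * p ^ a)) := by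
  rw [forall_sign_iff_exists_norm_neg Φ hU', ← exists_units_norm_eq_neg_one_iff hζ hn2]
  constructor
  · rintro ⟨v, hv⟩
    rcases norm_units_eq_one_or_eq_neg_one v with h | h
    · rw [h] at hv; norm_num at hv
    · exact ⟨v, h⟩
  · rintro ⟨v, hv⟩
    exact ⟨v, by rw [hv]; norm_num⟩

/-! ### §2 Every type occurs on every `ℤ[ζₙ]`-CM torus at the exceptional levels -/

section Tori

variable (Φ : CMType K) (𝔪 : (FractionalIdeal (𝓞 K)⁰ K)ˣ) {ζ₀ : K} {𝔣₀ : Ideal (𝓞 (maximalRealSubfield K))}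

/-- **EVERY TYPE OCCURS AT THE EXCEPTIONAL LEVELS.**  Let `K = ℚ(ζₙ)`, `n ≥ 3`, `n ∈ {2^a, p^a, 2p^a}`, `Φ` a CM type with
THEOREM L (ii), `𝔪` any lattice and `ζ₀ ≠ 0` a skew element of type `𝔣₀` on `D(𝔪)` (`IsOfType 𝔪 ζ₀ 𝔣₀`).  Then
`ℂ^Φ/D(𝔪)` carries a `Φ`-POSITIVE divisor of type `(K; Φ; 𝔣₀)` — whatever the parity of `#{φ ∈ Φ : Im ζ₀^φ < 0}`
(part 60 `exists_pos_isOfType_of_forall_sign` with §1's full signature).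
research route conditional on HC_CM; not a corollary; Q11.4-sentence-2 already refuted in dim ≥ 3. [cite: Shimura1998, §14.3 Prop. 5, p. 104] -/
theorem exists_pos_isOfType_of_exceptional [IsCyclotomicExtension {n} ℚ K] (hζ : IsPrimitiveRoot ζ n) (hn2 : 2 < n)
    (hex : (∃ a : ℕ, n = 2 ^ a) ∨ ∃ p a : ℕ, p.Prime ∧ p ≠ 2 ∧ (n = p ^ a ∨ n = 2 * p ^ a))
    (hζ₀ : IsCMField.complexConj K ζ₀ = -ζ₀) (h0 : ζ₀ ≠ 0) (hT : IsOfType 𝔪 ζ₀ 𝔣₀)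
    (hU' : ∀ S : Set (K →+* ℂ), S ⊆ Φ.1 → Even S.ncard →
      ∃ u : (𝓞 K)ˣ, IsCMField.complexConj K ((u : 𝓞 K) : K) = ((u : 𝓞 K) : K) ∧
        ∀ φ ∈ Φ.1, ((φ ((u : 𝓞 K) : K)).re < 0 ↔ φ ∈ S)) :
    ∃ ζ' : K, IsCMField.complexConj K ζ' = -ζ' ∧ (∀ φ : Φ.1, 0 < (φ.1 ζ').im) ∧ IsOfType 𝔪 ζ' 𝔣₀ :=
  exists_pos_isOfType_of_forall_sign Φ 𝔪 hζ₀ h0 hT (forall_sign_of_exceptional hζ hn2 hex Φ hU')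

end Tori

/-- `φ(n) = 2(k+1)` for `n ≥ 3`. [folklore] -/
theorem exists_totient_eq_two_mul_succ (hn2 : 2 < n) : ∃ k : ℕ, Nat.totient n = 2 * (k + 1) := by
  obtain ⟨d, hd⟩ := Nat.totient_even hn2
  have hpos := Nat.totient_pos.mpr (NeZero.pos n)
  refine ⟨d - 1, ?_⟩
  omega

/-- **AN `ι`-COMPATIBLE PRINCIPAL POLARISATION ON `ℂ^Φ/Φ(ℤ[ζₙ])` FOR EVERY `Φ` WITH L (ii), AT THE EXCEPTIONAL LEVELS**
(part 60 `exists_principal_of_forall_sign`; reference skew `ξ_k = ζ^k/Φₙ′(ζ)` of type `⊤`).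
research route conditional on HC_CM; not a corollary; Q11.4-sentence-2 already refuted in dim ≥ 3. [cite: Shimura1998, §14.3 Prop. 5, p. 104] -/
theorem exists_principal_of_exceptional [IsCyclotomicExtension {n} ℚ K] (hζ : IsPrimitiveRoot ζ n) (hn2 : 2 < n)
    (hex : (∃ a : ℕ, n = 2 ^ a) ∨ ∃ p a : ℕ, p.Prime ∧ p ≠ 2 ∧ (n = p ^ a ∨ n = 2 * p ^ a)) (Φ : CMType K)
    (hU' : ∀ S : Set (K →+* ℂ), S ⊆ Φ.1 → Even S.ncard →
      ∃ u : (𝓞 K)ˣ, IsCMField.complexConj K ((u : 𝓞 K) : K) = ((u : 𝓞 K) : K) ∧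
        ∀ φ ∈ Φ.1, ((φ ((u : 𝓞 K) : K)).re < 0 ↔ φ ∈ S)) :
    ∃ ζ' : K, IsCMField.complexConj K ζ' = -ζ' ∧ (∀ φ : Φ.1, 0 < (φ.1 ζ').im) ∧
        IsOfType (1 : (FractionalIdeal (𝓞 K)⁰ K)ˣ) ζ' ⊤ := by
  obtain ⟨k, hg⟩ := exists_totient_eq_two_mul_succ (n := n) hn2
  exact exists_principal_of_forall_sign hζ hg Φ (forall_sign_of_exceptional hζ hn2 hex Φ hU')

/-- **EVERY PRINCIPAL TYPE `(ϖ₀)` ON `ℂ^Φ/Φ(ℤ[ζₙ])` AT THE EXCEPTIONAL LEVELS**: for every CM type `Φ` with L (ii) and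
EVERY real `ϖ₀ ∈ 𝓞 K⁺ ∖ 0` a skew `Φ`-positive `ζ′` with `IsOfType 1 ζ′ (ϖ₀)` exists — an `ι`-compatible polarisation
of degree `|N_{K⁺/ℚ}(ϖ₀)|`, whatever the SIGN of `N(ϖ₀)` (contrast: at `n ∉ {2^a, p^a, 2p^a}` exactly one of `(ϖ₀)`,
`(ϖ₀′)` occurs when `N(ϖ₀)N(ϖ₀′) < 0`, parts 55/56/67).
research route conditional on HC_CM; not a corollary; Q11.4-sentence-2 already refuted in dim ≥ 3. [cite: Shimura1998, §14.3 Prop. 4–5, pp. 103–104] -/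
theorem exists_type_span_of_exceptional [IsCyclotomicExtension {n} ℚ K] (hζ : IsPrimitiveRoot ζ n) (hn2 : 2 < n)
    (hex : (∃ a : ℕ, n = 2 ^ a) ∨ ∃ p a : ℕ, p.Prime ∧ p ≠ 2 ∧ (n = p ^ a ∨ n = 2 * p ^ a)) (Φ : CMType K)
    {ϖ₀ : 𝓞 (maximalRealSubfield K)} (hϖ0 : ϖ₀ ≠ 0)
    (hU' : ∀ S : Set (K →+* ℂ), S ⊆ Φ.1 → Even S.ncard →
      ∃ u : (𝓞 K)ˣ, IsCMField.complexConj K ((u : 𝓞 K) : K) = ((u : 𝓞 K) : K) ∧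
        ∀ φ ∈ Φ.1, ((φ ((u : 𝓞 K) : K)).re < 0 ↔ φ ∈ S)) :
    ∃ ζ' : K, IsCMField.complexConj K ζ' = -ζ' ∧ (∀ φ : Φ.1, 0 < (φ.1 ζ').im) ∧
        IsOfType (1 : (FractionalIdeal (𝓞 K)⁰ K)ˣ) ζ' (Ideal.span {ϖ₀}) := by
  obtain ⟨k, hg⟩ := exists_totient_eq_two_mul_succ (n := n) hn2
  exact exists_type_span_of_forall_sign hζ hg Φ hϖ0 (forall_sign_of_exceptional hζ hn2 hex Φ hU')

end Summit.HodgeConjecture.Ring2WeilCoverage.FullSignatureExceptionalLevels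

end
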